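import Summits.Ventures.PercRepro.C041StarBoundsTwo

/-!
# STAR BOUNDS IV — `√A + √B ≤ 1` in polynomial form, `4AB ≤ (1 − A − B)²`, for stars with at least two leaves (mine-3, gen 64;
C-041.md §21 (ay) addendum 2)

With the last leaf `x` split off, `A = A′x`, `B = B′(1 − x)` and `A′ + B′ ≤ 1` (a star with at least one leaf), so
`(1 − A − B)² − 4AB ≥ (A′(1 − x) + B′x)² − 4A′B′x(1 − x) = (A′(1 − x) − B′x)² ≥ 0` — Cauchy–Schwarz for the two-leaf region
`R₂ = {√A + √B ≤ 1}` of §21 (aw).  It excludes the boxes with both `A, B > 1/4` from the cover.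
-/

namespace PercRepro

namespace TreeClosure

open Finset

/-- `4AB ≤ (1 − A − B)²` for a star with at least two leaves. -/
theorem four_mul_prod_mul_prod_one_sub_le {m : ℕ} (a : Fin (m + 2) → ℝ) (ha : ∀ i, 0 ≤ a i ∧ a i ≤ 1) :
    4 * ((∏ i, a i) * ∏ i, (1 - a i)) ≤ (1 - ∏ i, a i - ∏ i, (1 - a i)) ^ 2 := by
  have hsum := prod_add_prod_one_sub_le_one (fun i : Fin (m + 1) => a (Fin.castSucc i)) (fun i => ha _)
  obtain ⟨hA0, hA1⟩ := prod_unit_mem (fun i : Fin (m + 1) => a (Fin.castSucc i)) (fun i => ha _)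
  obtain ⟨hB0, hB1⟩ := prod_unit_mem (fun i : Fin (m + 1) => 1 - a (Fin.castSucc i))
    (fun i => ⟨by linarith [(ha (Fin.castSucc i)).2], by linarith [(ha (Fin.castSucc i)).1]⟩)
  obtain ⟨hx0, hx1⟩ := ha (Fin.last (m + 1))
  rw [Fin.prod_univ_castSucc (fun i => a i), Fin.prod_univ_castSucc (fun i => 1 - a i)]
  set A := ∏ i : Fin (m + 1), a (Fin.castSucc i)
  set B := ∏ i : Fin (m + 1), (1 - a (Fin.castSucc i))
  set x := a (Fin.last (m + 1))
  have h1 : 0 ≤ A * (1 - x) + B * x := by nlinarith [mul_nonneg hA0 (by linarith : (0:ℝ) ≤ 1 - x), mul_nonneg hB0 hx0]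
  have h2 : A * (1 - x) + B * x ≤ 1 - A * x - B * (1 - x) := by nlinarith [mul_nonneg hA0 (by linarith : (0:ℝ) ≤ 1 - x), mul_nonneg hB0 hx0]
  nlinarith [sq_nonneg (A * (1 - x) - B * x), mul_le_mul h2 h2 h1 (by linarith)]

end TreeClosure

end PercRepro
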